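import Summits.ABC.ABC.Theses.IsogenyGlueCongruence
import Summits.ABC.ABC.Theorems.IsogenyGlueCongruenceModularDatumExists
import Summits.ABC.ABC.Theorems.IsogenyGlueCongruenceSemistableHeightPolyBoundModular
import Summits.ABC.ABC.Theorems.IsogenyGlueCongruenceDegreePrimesPolyBoundedStubDiscValuation
import Literature.NumberTheory.EllipticCurves.PeriodRelationsProofs
import Literature.NumberTheory.EllipticCurves.PastenHeightBoundsClassicalInputProofs
import HarnessLib

/-!
# Crux A `DegreePrimesPolyBounded` (stmt-ABC-2045), line `newpart_congruence_friability` —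
# stub `stub_modularity`, RESHAPED to its semistable slice

The registered stub `stub_modularity : ModularDatumExists` is, definitionally, the named fact
`nonempty_modularParametrizationData` (every globally minimal elliptic `W/ℚ` carries a modular
parametrisation datum at level `N_W`), i.e. the full Modularity Theorem in datum form
(Breuil–Conrad–Diamond–Taylor 2001, Thm. A; unconditionally equivalent to `exists_isNewformOf`,
`Summit.ABC.ABC.Theorems.modularDatumExists_iff_exists_isNewformOf`). It is not proved here.

The line consumes modularity only for SEMISTABLE curves: (i) in the glue hypothesis (a datum of the
semistable `W` at hand) and (ii) inside the valuation bound `v_p(Δ_min(W)) ≤ C · N_W²`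
(`discValuation_of_modularity_of_mazurKenku` of the frame), whose chain
`exists_neronLatticeHeight_le_half_mul_log` → `pasten2024_eq_3_4_classMinimal_of_modularity_of_mazurKenku`
→ `pasten2024_eq_3_4_of_modularity` applies `hmod` ONLY to the curve `W` at hand (`hmod W`, three
times: a datum of `W`, a datum of `W` of minimal degree, and again a datum of `W` of minimal degree).
This file re-threads that chain PER CURVE — every lemma takes the datum of the curve it talks about
as a hypothesis `Nonempty (ModularParametrizationData W N_W)` — and lands

* `stub_discValuationOfSemistableModularity` — the valuation bound `v_p(Δ_min(W)) ≤ C · N_W^κ` for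
  semistable globally minimal `W` from the SEMISTABLE SLICE of modularity and Mazur–Kenku
  (`PastenShimura2024_minimalDegree_le_163_mul`) alone (Pasten Thm 5.5 being the tree theorem
  `PastenShimura2024_thm_5_5_holds`);
* `discValuation_of_nonempty_of_mazurKenku` — the same bound for EVERY globally minimal elliptic
  `W/ℚ` that has a datum (no semistability);
* `discValuation_of_CDT_theorem_7_1_2_of_mazurKenku` — the semistable bound with the slice supplied
  by the smaller named fact `BCDT.CDT_theorem_7_1_2` (Conrad–Diamond–Taylor 1999, Thm. 7.1.2, which
  contains Wiles / Taylor–Wiles for semistable curves) through the tree theorem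
  `nonempty_modularParametrizationData_of_isSemistable_of_CDT_theorem_7_1_2`.

So the trust base of input (ii) of the line shrinks from BCDT Thm. A to CDT Thm. 7.1.2 (+ Mazur–Kenku).
No new definition; no named fact is discharged.

## References

* [PastenShimura2024] H. Pasten, *Shimura curves and the abc conjecture*, J. Number Theory 254
  (2024) 214–335: §3 p. 13 ((EqFrey), (EqHDeg), Mazur–Kenku), Thm 5.5, Thm 7.2, Lemma 18.1.
* [MurtyPasten2013] M. R. Murty, H. Pasten, *Modular forms and effective Diophantine
  approximation*, J. Number Theory 133 (2013), Thm 1.1.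
* [ConradDiamondTaylor1999] B. Conrad, F. Diamond, R. Taylor, J. Amer. Math. Soc. 12 (1999),
  Thm. 7.1.2.
-/

-- `Summit.ABC.ABC` is the mandated summit-side namespace (CONVENTIONS §2); the duplicate is
-- deliberate.
set_option linter.dupNamespace false

noncomputable section

open scoped MatrixGroups ModularForm
open CongruenceSubgroup
open Literature.NumberTheory.EllipticCurves
open Literature.NumberTheory.EllipticCurves.ModularForms
open Literature.NumberTheory.EllipticCurves.Pasten2024
open Literature.NumberTheory.Automorphic
open Summit.ABC.ABC.Theses.IsogenyGlueCongruence

namespace Summit.ABC.ABC.Theorems.DegreePrimesPolyBounded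

/-! ### (EqHDeg) per curve, from the curve's own datum -/

/-- **(EqHDeg), minimal-degree-of-`W` form, per curve**: if the elliptic `W/ℚ` has a modular
parametrisation datum at level `N_W`, then for every period pair `L` spanning its Néron lattice
`h(E) = neronLatticeHeight L ≤ ½ log(minModularDegree W N_W) + (2π − ½ log π)`. The proof of
`pasten2024_eq_3_4_of_modularity` with `hmod W` replaced by the hypothesis `hW`: a datum `D` of
`W` of minimal degree (`exists_modularDegree_eq_minModularDegree`), Zagier's identity solved for the
covolume with `c² ≥ 1` (`Pasten2024.twelve_mul_neronLatticeHeight_le`), the trivial Petersson bound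
(`IsNewformOf.peterssonProduct_re_ge`), and `h(L) = h(D.L)` (`neronLatticeHeight_eq_of_isNeronLatticeOf`).
[cite: PastenShimura2024, §3 p. 13, (EqFrey)–(EqHDeg)] -/
theorem neronLatticeHeight_le_log_minModularDegree_of_nonempty
    (W : WeierstrassCurve ℚ) [W.IsElliptic] [NeZero (W.conductorNorm ℤ)]
    (hW : Nonempty (ModularParametrizationData W (W.conductorNorm ℤ)))
    (L : PeriodPair) (hL : IsNeronLatticeOf (W.baseChange ℂ) L) :
    neronLatticeHeight L ≤
      Real.log (minModularDegree W (W.conductorNorm ℤ) : ℝ) / 2 +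
        (2 * Real.pi - Real.log Real.pi / 2) := by
  -- adapted from `pasten2024_eq_3_4_of_modularity` (PastenHeightBoundsClassicalInputProofs)
  obtain ⟨D, hDmin⟩ := exists_modularDegree_eq_minModularDegree hW
  have hc₀ : 0 < Real.exp (-(4 * Real.pi)) / (4 * Real.pi) := by positivity
  have hP : Real.exp (-(4 * Real.pi)) / (4 * Real.pi) ≤
      (peterssonProduct (Gamma0 (W.conductorNorm ℤ)) 2 D.f D.f).re :=
    D.isNewformOf.peterssonProduct_re_ge
  have hh := twelve_mul_neronLatticeHeight_le D hc₀ hP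
  rw [log_four_pi_sq_mul_trivialPeterssonConst, ModularParametrizationData.deg_eq_modularDegree,
    hDmin] at hh
  rw [neronLatticeHeight_eq_of_isNeronLatticeOf hL D.isNeronLattice]
  linarith

/-- **(EqHDeg) verbatim, per curve: `h(E) ≤ ½ log δ_{1,N} + 9`** for a globally minimal elliptic
`W/ℚ` WITH A DATUM at level `N_W`, every Néron period pair `L` of `W`, and every datum `D₀` (of some
elliptic `W₀/ℚ`) with the newform of `W` which is of minimal degree in the class at level `N_W`
(`D₀.modularDegree = δ_{1,N}`). The proof of
`pasten2024_eq_3_4_classMinimal_of_modularity_of_mazurKenku` with `hmod W` replaced by `hW`: the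
minimal datum `D'` of `W` (`exists_minimal_datum hW`) has newform `D₀.f` (`IsNewformOf.unique`),
`deg D' ≤ 163 · deg D₀` by Mazur–Kenku (`h163`), then
`neronLatticeHeight_le_log_minModularDegree_of_nonempty` and `½ log 163 + 2π − ½ log π ≤ 9`
(`two_pi_sub_half_log_pi_le`). [cite: PastenShimura2024, §3 p. 13, (EqHDeg)] -/
theorem neronLatticeHeight_le_log_classMinimalDegree_of_nonempty
    (h163 : PastenShimura2024_minimalDegree_le_163_mul)
    (W : WeierstrassCurve ℚ) [W.IsElliptic] [W.IsGloballyMinimal] [NeZero (W.conductorNorm ℤ)]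
    (hW : Nonempty (ModularParametrizationData W (W.conductorNorm ℤ)))
    (L : PeriodPair) (hL : IsNeronLatticeOf (W.baseChange ℂ) L)
    {W₀ : WeierstrassCurve ℚ} [W₀.IsElliptic] (D₀ : ModularParametrizationData W₀ (W.conductorNorm ℤ))
    (hf : IsNewformOf W D₀.f)
    (hmin : ∀ (W'' : WeierstrassCurve ℚ) [W''.IsElliptic]
      (D'' : ModularParametrizationData W'' (W.conductorNorm ℤ)),
      D''.f = D₀.f → D₀.modularDegree ≤ D''.modularDegree) :
    neronLatticeHeight L ≤ Real.log (D₀.modularDegree : ℝ) / 2 + 9 := by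
  -- adapted from `pasten2024_eq_3_4_classMinimal_of_modularity_of_mazurKenku`
  obtain ⟨D', hD'min, hD'le⟩ := exists_minimal_datum hW
  have hf' : D'.f = D₀.f := D'.isNewformOf.unique hf
  have hle : D'.modularDegree ≤ 163 * D₀.modularDegree :=
    h163 (W.conductorNorm ℤ) W₀ W D₀ D' hf' hmin hD'le
  have hd₀ : (0 : ℝ) < D₀.modularDegree := by exact_mod_cast D₀.deg_pos
  have hd' : (0 : ℝ) < D'.modularDegree := by exact_mod_cast D'.deg_pos
  have hlog : Real.log (minModularDegree W (W.conductorNorm ℤ) : ℝ) ≤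
      Real.log 163 + Real.log (D₀.modularDegree : ℝ) := by
    rw [← hD'min, ← Real.log_mul (by norm_num) hd₀.ne']
    exact Real.log_le_log hd' (by exact_mod_cast hle)
  have h := neronLatticeHeight_le_log_minModularDegree_of_nonempty W hW L hL
  have hc := two_pi_sub_half_log_pi_le
  linarith

/-! ### `h(E) ≤ ½ N log N + 9` for `N ≫ 1`, per curve -/

/-- **Murty–Pasten, crude form, per curve: `h(E) ≤ ½ N log N + 9` for `N ≫ 1`.** There is `N₂`
such that for every globally minimal elliptic `W/ℚ` WITH A DATUM at level `N_W ≥ N₂` and every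
Néron period pair `L` of `W`, `neronLatticeHeight L ≤ ½ N_W log N_W + 9`. The proof of
`Summit.ABC.ABC.Theorems.exists_neronLatticeHeight_le_half_mul_log` with `hmod W` replaced by the
per-curve hypothesis: a datum `D'` of `W`, a class-minimal datum `D₀` with the same newform
(`Pasten2024.exists_minimal_datum_in_class`), (EqHDeg)
(`neronLatticeHeight_le_log_classMinimalDegree_of_nonempty`, Mazur–Kenku `h163`) and
`log δ_{1,N} ≤ N log N` for `N ≥ N₂` (`exists_log_modularDegree_le_mul_log`, from Pasten's Thm 5.5,
the tree THEOREM `PastenShimura2024_thm_5_5_holds`). [cite: MurtyPasten2013, Thm 1.1]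
[cite: PastenShimura2024, §3 p. 13 and Thm. 7.2] -/
theorem exists_neronLatticeHeight_le_half_mul_log_of_nonempty
    (h163 : PastenShimura2024_minimalDegree_le_163_mul) :
    ∃ N₂ : ℕ, ∀ (W : WeierstrassCurve ℚ) [W.IsElliptic] [W.IsGloballyMinimal]
      [NeZero (W.conductorNorm ℤ)], Nonempty (ModularParametrizationData W (W.conductorNorm ℤ)) →
      ∀ (L : PeriodPair), IsNeronLatticeOf (W.baseChange ℂ) L → N₂ ≤ W.conductorNorm ℤ →
        neronLatticeHeight L ≤ (W.conductorNorm ℤ : ℝ) * Real.log (W.conductorNorm ℤ) / 2 + 9 := by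
  -- adapted from `Summit.ABC.ABC.Theorems.exists_neronLatticeHeight_le_half_mul_log`
  obtain ⟨N₂, hN₂⟩ :=
    Summit.ABC.ABC.Theorems.exists_log_modularDegree_le_mul_log PastenShimura2024_thm_5_5_holds
  refine ⟨N₂, fun W _ _ _ hW L hL hN => ?_⟩
  obtain ⟨D'⟩ := hW
  obtain ⟨W₀, hW₀, D₀, hf, hmin⟩ := exists_minimal_datum_in_class D'
  have hfW : IsNewformOf W D₀.f := by rw [hf]; exact D'.isNewformOf
  have hh := neronLatticeHeight_le_log_classMinimalDegree_of_nonempty h163 W ⟨D'⟩ L hL D₀ hfW hmin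
  have hδ := hN₂ (W.conductorNorm ℤ) W₀ D₀ hmin hN
  linarith

/-! ### `h(E/ℚ) ≤ c · N²` and `v_p(Δ_min) ≤ C · N²`, per curve -/

/-- **`h(E/ℚ) ≤ c · N_W²` for every globally minimal elliptic `W/ℚ` with a datum**, from
Mazur–Kenku alone: above the threshold `N₂` of
`exists_neronLatticeHeight_le_half_mul_log_of_nonempty`, `h(E/ℚ) = neronLatticeHeight L`
(`faltingsHeight_eq_neronLatticeHeight`, `exists_isNeronLatticeOf_holds`) is
`≤ ½ N log N + 9 ≤ 10 N²` (`log N ≤ N`); below it, `h(E/ℚ) ≤ B` by Shafarevich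
(`exists_faltingsHeight_le_of_conductorNorm_lt`); `c = max B 10`. (The frame's
`discValuation_of_modularity_of_mazurKenku`, block `hc`, per curve.)
[cite: MurtyPasten2013, Thm 1.1] [cite: SilvermanAEC2009, Thm. IX.6.1] -/
theorem exists_faltingsHeight_le_sq_of_nonempty (h163 : PastenShimura2024_minimalDegree_le_163_mul) :
    ∃ c : ℝ, ∀ (W : WeierstrassCurve ℚ) [W.IsElliptic] [W.IsGloballyMinimal]
      [NeZero (W.conductorNorm ℤ)], Nonempty (ModularParametrizationData W (W.conductorNorm ℤ)) →
        W.faltingsHeight ≤ c * (W.conductorNorm ℤ : ℝ) ^ 2 := by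
  obtain ⟨N₂, hN₂⟩ := exists_neronLatticeHeight_le_half_mul_log_of_nonempty h163
  obtain ⟨B, hB⟩ := exists_faltingsHeight_le_of_conductorNorm_lt N₂
  refine ⟨max B 10, fun W _ _ _ hW => ?_⟩
  have hN1 : (1 : ℝ) ≤ (W.conductorNorm ℤ : ℝ) := by
    exact_mod_cast Nat.one_le_iff_ne_zero.2 (NeZero.ne _)
  have hc0 : (0 : ℝ) ≤ max B 10 := le_trans (by norm_num) (le_max_right _ _)
  have hsq : (1 : ℝ) ≤ (W.conductorNorm ℤ : ℝ) ^ 2 := by nlinarith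
  by_cases hN : N₂ ≤ W.conductorNorm ℤ
  · obtain ⟨L, hL⟩ := exists_isNeronLatticeOf_holds (W.baseChange ℂ)
    have hle := hN₂ W hW L hL hN
    have hlog : Real.log (W.conductorNorm ℤ : ℝ) ≤ (W.conductorNorm ℤ : ℝ) :=
      (Real.log_le_sub_one_of_pos (by linarith)).trans (by linarith)
    have hNN : (W.conductorNorm ℤ : ℝ) * Real.log (W.conductorNorm ℤ) ≤
        (W.conductorNorm ℤ : ℝ) ^ 2 := by
      rw [sq]
      exact mul_le_mul_of_nonneg_left hlog (by linarith)
    calc W.faltingsHeight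
          = neronLatticeHeight L := Summit.ABC.ABC.Theorems.faltingsHeight_eq_neronLatticeHeight W hL
      _ ≤ (W.conductorNorm ℤ : ℝ) * Real.log (W.conductorNorm ℤ) / 2 + 9 := hle
      _ ≤ (W.conductorNorm ℤ : ℝ) ^ 2 / 2 + 9 * (W.conductorNorm ℤ : ℝ) ^ 2 := by
          have h9 : (9 : ℝ) ≤ 9 * (W.conductorNorm ℤ : ℝ) ^ 2 := by nlinarith
          linarith
      _ ≤ 10 * (W.conductorNorm ℤ : ℝ) ^ 2 := by nlinarith
      _ ≤ max B 10 * (W.conductorNorm ℤ : ℝ) ^ 2 :=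
          mul_le_mul_of_nonneg_right (le_max_right _ _) (by positivity)
  · have hlt : W.conductorNorm ℤ < N₂ := lt_of_not_ge hN
    calc W.faltingsHeight ≤ B := hB W hlt
      _ ≤ max B 10 := le_max_left _ _
      _ = max B 10 * 1 := (mul_one _).symm
      _ ≤ max B 10 * (W.conductorNorm ℤ : ℝ) ^ 2 := mul_le_mul_of_nonneg_left hsq hc0

/-- **`v_p(Δ_min(W)) ≤ C · N_W^κ` (`κ = 2`) for every globally minimal elliptic `W/ℚ` WITH A DATUM
and every `p`**, from Mazur–Kenku (`h163`) alone: `h(E/ℚ) ≤ c N²`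
(`exists_faltingsHeight_le_sq_of_nonempty`), `log|Δ_min| < 12 h + 16` (Pasten Lemma 18.1,
`log_minimalDiscriminantNorm_int_lt_faltingsHeight`) and `v_p(n) ≤ log n / log 2`
(`factorization_le_of_log_le`). No semistability. [cite: PastenShimura2024, §3 (3.1) and Lemma 18.1] -/
theorem discValuation_of_nonempty_of_mazurKenku (h163 : PastenShimura2024_minimalDegree_le_163_mul) :
    ∃ κ C : ℝ, ∀ (W : WeierstrassCurve ℚ) [W.IsElliptic] [W.IsGloballyMinimal]
      [NeZero (W.conductorNorm ℤ)], Nonempty (ModularParametrizationData W (W.conductorNorm ℤ)) →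
        ∀ p : ℕ, (((W.minimalDiscriminantNorm ℤ).factorization p : ℕ) : ℝ) ≤
          C * (W.conductorNorm ℤ : ℝ) ^ κ := by
  obtain ⟨c, hc⟩ := exists_faltingsHeight_le_sq_of_nonempty h163
  refine ⟨2, max (12 * c + 16) 0 / Real.log 2, fun W _ _ _ hW p => ?_⟩
  have hN1 : (1 : ℝ) ≤ (W.conductorNorm ℤ : ℝ) := by
    exact_mod_cast Nat.one_le_iff_ne_zero.2 (NeZero.ne _)
  have hsq : (1 : ℝ) ≤ (W.conductorNorm ℤ : ℝ) ^ 2 := by nlinarith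
  have h1 := log_minimalDiscriminantNorm_int_lt_faltingsHeight W
  have h2 : 12 * W.faltingsHeight ≤ 12 * (c * (W.conductorNorm ℤ : ℝ) ^ 2) :=
    mul_le_mul_of_nonneg_left (hc W hW) (by norm_num)
  have hlog : Real.log (W.minimalDiscriminantNorm ℤ) ≤ (12 * c + 16) * (W.conductorNorm ℤ : ℝ) ^ 2 := by
    have h3 : (12 * c + 16) * (W.conductorNorm ℤ : ℝ) ^ 2 =
        12 * (c * (W.conductorNorm ℤ : ℝ) ^ 2) + 16 * (W.conductorNorm ℤ : ℝ) ^ 2 := by ring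
    rw [h3]
    linarith
  exact factorization_le_of_log_le NeZero.one_le hlog p

/-! ### The reshaped stub: the valuation bound from the SEMISTABLE slice of modularity -/

/-- STUB (reshape of the registered `stub_modularity`, semistable slice) — **`v_p(Δ_min(W)) ≤
C · N_W^κ` for every semistable globally minimal elliptic `W/ℚ` and every `p`, from the SEMISTABLE
SLICE of modularity in datum form and Mazur–Kenku.** Hypotheses: (1) every semistable globally
minimal elliptic `W/ℚ` carries a `ModularParametrizationData W N_W` (Wiles 1995 Thm 0.4 +
Taylor–Wiles; in the tree from `BCDT.CDT_theorem_7_1_2` by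
`nonempty_modularParametrizationData_of_isSemistable_of_CDT_theorem_7_1_2`, see
`discValuation_of_CDT_theorem_7_1_2_of_mazurKenku`); (2) `PastenShimura2024_minimalDegree_le_163_mul`
(Mazur 1978 + Kenku 1982 via Pasten 2024 §3). Conclusion: verbatim the conclusion of the frame's
`discValuation_of_modularity_of_mazurKenku` (hypothesis `h6` of the glue), now without
`nonempty_modularParametrizationData`: the chain (EqHDeg) → `h ≤ ½ N log N + 9` (Thm 5.5, PROVED)
→ Shafarevich → Lemma 18.1 → `v_p ≤ log/log 2` applies modularity only to the curve at hand
(`discValuation_of_nonempty_of_mazurKenku`). [cite: PastenShimura2024, §3 p. 13, Thm. 7.2, Lemma 18.1]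
[cite: MurtyPasten2013, Thm 1.1] -/
theorem stub_discValuationOfSemistableModularity :
    (∀ (W : WeierstrassCurve ℚ) [W.IsElliptic] [W.IsGloballyMinimal] [NeZero (W.conductorNorm ℤ)],
      W.IsSemistable ℤ → Nonempty (ModularParametrizationData W (W.conductorNorm ℤ))) →
    PastenShimura2024_minimalDegree_le_163_mul →
    ∃ κ C : ℝ, ∀ (W : WeierstrassCurve ℚ) [W.IsElliptic] [W.IsGloballyMinimal]
      [NeZero (W.conductorNorm ℤ)], W.IsSemistable ℤ → ∀ p : ℕ,
        (((W.minimalDiscriminantNorm ℤ).factorization p : ℕ) : ℝ) ≤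
          C * (W.conductorNorm ℤ : ℝ) ^ κ := by
  intro hslice h163
  obtain ⟨κ, C, h⟩ := discValuation_of_nonempty_of_mazurKenku h163
  exact ⟨κ, C, fun W _ _ _ hss p => h W (hslice W hss) p⟩

/-- **The valuation bound for semistable curves from Conrad–Diamond–Taylor 1999, Thm. 7.1.2, and
Mazur–Kenku**: `stub_discValuationOfSemistableModularity` with its modularity slice supplied by the
named fact `BCDT.CDT_theorem_7_1_2` (conductor not divisible by `27` ⟹ modular; for semistable
curves Wiles 1995 Thm 0.4 / Taylor–Wiles) through the tree theorem
`nonempty_modularParametrizationData_of_isSemistable_of_CDT_theorem_7_1_2` (a semistable curve has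
squarefree conductor). CONDITIONAL on `BCDT.CDT_theorem_7_1_2` and
`PastenShimura2024_minimalDegree_le_163_mul`. [cite: ConradDiamondTaylor1999, Thm. 7.1.2]
[cite: PastenShimura2024, §3 p. 13] -/
theorem discValuation_of_CDT_theorem_7_1_2_of_mazurKenku (h712 : BCDT.CDT_theorem_7_1_2)
    (h163 : PastenShimura2024_minimalDegree_le_163_mul) :
    ∃ κ C : ℝ, ∀ (W : WeierstrassCurve ℚ) [W.IsElliptic] [W.IsGloballyMinimal]
      [NeZero (W.conductorNorm ℤ)], W.IsSemistable ℤ → ∀ p : ℕ,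
        (((W.minimalDiscriminantNorm ℤ).factorization p : ℕ) : ℝ) ≤
          C * (W.conductorNorm ℤ : ℝ) ^ κ :=
  stub_discValuationOfSemistableModularity
    (fun W _ _ _ hW ↦
      Summit.ABC.ABC.Theorems.nonempty_modularParametrizationData_of_isSemistable_of_CDT_theorem_7_1_2
        h712 W hW)
    h163

/-- **The valuation bound for semistable curves from the Modularity Theorem "version `a_p`"
(`exists_isNewformOf`, BCDT 2001 Thm. A; only its semistable case is used) and Mazur–Kenku**, through
`nonempty_modularParametrizationData_of_isSemistable_of_exists_isNewformOf`. CONDITIONAL on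
`exists_isNewformOf` and `PastenShimura2024_minimalDegree_le_163_mul`. [cite: Wiles1995, Thm. 0.4]
[cite: PastenShimura2024, §3 p. 13] -/
theorem discValuation_of_exists_isNewformOf_of_mazurKenku (hmod : exists_isNewformOf)
    (h163 : PastenShimura2024_minimalDegree_le_163_mul) :
    ∃ κ C : ℝ, ∀ (W : WeierstrassCurve ℚ) [W.IsElliptic] [W.IsGloballyMinimal]
      [NeZero (W.conductorNorm ℤ)], W.IsSemistable ℤ → ∀ p : ℕ,
        (((W.minimalDiscriminantNorm ℤ).factorization p : ℕ) : ℝ) ≤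
          C * (W.conductorNorm ℤ : ℝ) ^ κ :=
  stub_discValuationOfSemistableModularity
    (fun W _ _ _ hW ↦
      Summit.ABC.ABC.Theorems.nonempty_modularParametrizationData_of_isSemistable_of_exists_isNewformOf
        hmod W hW)
    h163

/-- **The semistable slice of the registered stub is implied by the registered stub** (so the
reshape loses nothing: `ModularDatumExists` gives hypothesis (1) of
`stub_discValuationOfSemistableModularity` by forgetting semistability). [folklore] -/
theorem semistableModularDatum_of_modularDatumExists (hmod : ModularDatumExists) :
    ∀ (W : WeierstrassCurve ℚ) [W.IsElliptic] [W.IsGloballyMinimal] [NeZero (W.conductorNorm ℤ)],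
      W.IsSemistable ℤ → Nonempty (ModularParametrizationData W (W.conductorNorm ℤ)) :=
  fun W _ _ _ _ ↦ hmod W

end Summit.ABC.ABC.Theorems.DegreePrimesPolyBounded

end
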